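import Mathlib
import Summits.MatrixMultiplication.MatrixMultiplication.Theses.MatrixPointInterpolation

/-!
# Route MatrixPointInterpolation — support `PointCount`

The point-count step of the Chudnovsky–Chudnovsky interpolation diagram transferred to matrix
points (Bürgisser–Clausen–Shokrollahi 1997, Prop. 18.22, choice of the `r = dim L(2mP)`
evaluation places): if a pair `A ∈ M_n(ℂ)²` masquerades as `M_k` to degree `2d`, then there are
`N ≤ dim W` points `B_t ∈ M_k(ℂ)²`, where `W` is the span of the word-functions of length `≤ 2d`
on pairs of `k × k` matrices, such that every linear combination of words of length `≤ 2d`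
vanishing at the `N` points vanishes at `A`.

The content is pure finite-dimensional linear algebra: for a finite-dimensional subspace `K` of a
function space `X → M`, a greedy choice of at most `finrank K` points makes evaluation injective on
`K` (each new point strictly shrinks the joint kernel).  The masquerade hypothesis then transfers
vanishing from "all pairs of `k × k` matrices" to `A`.
-/

-- `Summit.MatrixMultiplication.MatrixMultiplication.…` is the tree's mandated summit-side namespace
-- (single-conjunct summit: Sub = Summit), which the `dupNamespace` linter would flag on every decl.
set_option linter.dupNamespace false

namespace Summit.MatrixMultiplication.MatrixMultiplication.Theorems

open scoped BigOperators

/-- Greedy point choice (kernel shrinking).  For a finite-dimensional submodule `K` of a function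
space `X → M` over a division ring there are `N ≤ finrank K` points `B : Fin N → X` such that a
member of `K` vanishing at every `B t` is zero.  Auxiliary form with an explicit bound `m` on the
dimension, proved by induction on `m`. -/
theorem exists_eval_points_of_finrank_le {𝕜 X M : Type*} [DivisionRing 𝕜] [AddCommGroup M]
    [Module 𝕜 M] (m : ℕ) :
    ∀ (K : Submodule 𝕜 (X → M)), FiniteDimensional 𝕜 K → Module.finrank 𝕜 K ≤ m →
      ∃ (N : ℕ) (B : Fin N → X), N ≤ Module.finrank 𝕜 K ∧
        ∀ f ∈ K, (∀ t, f (B t) = 0) → f = 0 := by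
  induction m with
  | zero =>
    intro K _ hm
    refine ⟨0, Fin.elim0, Nat.zero_le _, fun f hf _ => ?_⟩
    have hbot : K = ⊥ := Submodule.finrank_eq_zero.mp (Nat.le_zero.mp hm)
    rw [hbot] at hf
    exact (Submodule.mem_bot 𝕜).mp hf
  | succ m ih =>
    intro K _ hm
    by_cases hK0 : ∀ f ∈ K, f = 0
    · exact ⟨0, Fin.elim0, Nat.zero_le _, fun f hf _ => hK0 f hf⟩
    · push Not at hK0
      obtain ⟨f, hfK, hf0⟩ := hK0
      obtain ⟨x, hx⟩ : ∃ x, f x ≠ 0 := Function.ne_iff.mp hf0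
      let K' : Submodule 𝕜 (X → M) := K ⊓ LinearMap.ker (LinearMap.proj x)
      have hlt : K' < K := by
        refine lt_of_le_of_ne inf_le_left fun h => hx ?_
        have hf' : f ∈ K' := h.symm ▸ hfK
        exact hf'.2
      have hfin : Module.finrank 𝕜 K' < Module.finrank 𝕜 K :=
        Submodule.finrank_lt_finrank_of_lt hlt
      obtain ⟨N, B, hN, hB⟩ := ih K' inferInstance (by omega)
      refine ⟨N + 1, Fin.cons x B, by omega, fun g hg hz => ?_⟩
      have hgx : g x = 0 := by simpa using hz 0
      have hg' : g ∈ K' := ⟨hg, by simpa using hgx⟩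
      exact hB g hg' fun t => by simpa using hz t.succ

/-- Greedy point choice (kernel shrinking): for a finite-dimensional submodule `K` of a function
space `X → M` over a division ring there are `N ≤ finrank K` points `B : Fin N → X` such that
evaluation at these points is injective on `K`, i.e. a member of `K` vanishing at every `B t`
is the zero function. -/
theorem exists_eval_points {𝕜 X M : Type*} [DivisionRing 𝕜] [AddCommGroup M] [Module 𝕜 M]
    (K : Submodule 𝕜 (X → M)) [FiniteDimensional 𝕜 K] :
    ∃ (N : ℕ) (B : Fin N → X), N ≤ Module.finrank 𝕜 K ∧
      ∀ f ∈ K, (∀ t, f (B t) = 0) → f = 0 :=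
  exists_eval_points_of_finrank_le (Module.finrank 𝕜 K) K inferInstance le_rfl

/-- **PointCount** (route MatrixPointInterpolation, support item; BCS 1997 Prop. 18.22, choice of
the evaluation places, transferred to matrix points).  If `A ∈ M_n(ℂ)²` masquerades as `M_k` to
degree `2d`, then there are `N` points `B_t ∈ M_k(ℂ)²`, `N` at most the dimension of the span of
the word-functions of length `≤ 2d` on pairs of `k × k` matrices, such that every linear
combination of words of length `≤ 2d` vanishing at all `B_t` vanishes at `A`.  Proof: the span is
finite-dimensional (finitely many words of bounded length), `exists_eval_points` gives points at
which evaluation is injective on it, so a combination vanishing at the points vanishes at every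
pair of `k × k` matrices, and the masquerade hypothesis concludes. -/
theorem pointCount_proof :
    Summit.MatrixMultiplication.MatrixMultiplication.Theses.MatrixPointInterpolation.PointCount := by
  unfold Summit.MatrixMultiplication.MatrixMultiplication.Theses.MatrixPointInterpolation.PointCount
  intro n k d A hA
  have hSfin : {f : (Fin 2 → Matrix (Fin k) (Fin k) ℂ) → Matrix (Fin k) (Fin k) ℂ |
      ∃ w : List (Fin 2), w.length ≤ 2 * d ∧ f = fun B => (w.map B).prod}.Finite := by
    refine ((List.finite_length_le (Fin 2) (2 * d)).image
      (fun w : List (Fin 2) => fun B : Fin 2 → Matrix (Fin k) (Fin k) ℂ => (w.map B).prod)).subset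
      ?_
    rintro f ⟨w, hw, rfl⟩
    exact ⟨w, hw, rfl⟩
  haveI := FiniteDimensional.span_of_finite ℂ hSfin
  obtain ⟨N, B, hN, hB⟩ := exists_eval_points (Submodule.span ℂ
    {f : (Fin 2 → Matrix (Fin k) (Fin k) ℂ) → Matrix (Fin k) (Fin k) ℂ |
      ∃ w : List (Fin 2), w.length ≤ 2 * d ∧ f = fun B => (w.map B).prod})
  refine ⟨N, B, hN, fun T c hT hz => hA T c hT fun B' => ?_⟩
  have hF : (∑ w ∈ T, c w • fun B : Fin 2 → Matrix (Fin k) (Fin k) ℂ => (w.map B).prod) ∈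
      Submodule.span ℂ {f : (Fin 2 → Matrix (Fin k) (Fin k) ℂ) → Matrix (Fin k) (Fin k) ℂ |
        ∃ w : List (Fin 2), w.length ≤ 2 * d ∧ f = fun B => (w.map B).prod} :=
    Submodule.sum_mem _ fun w hw =>
      Submodule.smul_mem _ _ (Submodule.subset_span ⟨w, hT w hw, rfl⟩)
  have h0 := hB _ hF fun t => by simpa [Finset.sum_apply, Pi.smul_apply] using hz t
  simpa [Finset.sum_apply, Pi.smul_apply] using congrFun h0 B'

end Summit.MatrixMultiplication.MatrixMultiplication.Theorems
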